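import Summits.QuantumFields.YangMills.Theorems.UnitScaleTiltProp7CurrentSlavingFlat
import Summits.QuantumFields.YangMills.Theorems.UnitScaleTiltProp7FlatSliceRegularity
import Summits.QuantumFields.YangMills.Theorems.UnitScaleTiltProp7FlatCurlCurl
import HarnessLib

/-!
# Route `UnitScaleTilt`, crux K1 child «MinimiserStabilityRegPr» (stmt-QuantumFields-19200), registered stub `stub_prop7From14` (V3, skeleton v7
# cc37a1787726) — lane B: **THE EXACTLY CRITICAL FLAT MODEL — (127) ⇒ the linearised current `∂*∂A` is SLAVED to the plaquette variable `∂A`: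
# `sup|∂*∂A| ≤ 6(d − 1)·c·L^{−k}·sup|∂A| + 4·sup|r|`** (one level, V1 letters of lit-balaban, every torus of `Setup`; at the top scale `c = L^k` the factor
# is `6(d − 1)`): the `p = 0` instance of «the current is slaved to the curvature under the Euler–Lagrange port»

Cell `ym3-torus` ∕ fleet seat `ym-ust-19200-p3` (WIDTH-LEVER lane B of V3; HUMAN RULING D-0037, YM ladder rung R3).  `--supports stmt-QuantumFields-19200
--as helper`.  Companion of g0's `Prop7FlatSliceRegularity.abs_le_of_critical_T3` (which bounds the FIELD `A` through the Green's-function letters `C_G`, `C_H`):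
here the CURRENT `∂*∂A` is bounded with NO Green's function — by `(ker Q)ᗮ = range Q*` (`exists_QsE_eq_of_orth_ker`), the V1 dictionary
`QsE_twoScale_empty_apply`, the range bound `abs_le_of_sub_adjField_le` (p1 lineage's diagonally dominant normal operator) and the tent–Stokes telescoping
`abs_bondAvgIter_le_of_transverseDiff` applied to the explicit curl–curl operator `dcsE_dcE_apply` of g0's `Prop7FlatCurlCurl`.

WHAT IS PROVED (sorry-free, no definition, standard axioms; one level `twoScale k _ ∅`, any lattice factor `c`):
* `abs_bondAvgIter_dcsE_dcE_le`: `|Q_k(∂*∂y)(c′)| ≤ 2(d − 1)·c²·(L^k)⁻¹·G` whenever every plaquette-type combination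
  `|y(x,ν) + y(x+e_ν,μ) − y(x+e_μ,ν) − y(x,μ)| ≤ G`;
* **`abs_dcsE_dcE_le_of_critical`**: `⟨δ, ∂*∂y + r⟩ = 0` for all `δ` with `Qδ = 0`, `sup|r| ≤ ρ` ⇒ `|(∂*∂y)(b)| ≤ 6(d − 1)·c²·(L^k)⁻¹·G + 4ρ` at every bond.
HONEST SCOPE.  Linear algebra + lattice calculus on the flat one-level model (the exact Euler–Lagrange case of (127)); nothing of Bałaban's nonlinear analysis;
not a claim about the mass gap.

References: T. Bałaban, CMP **102** (1985) 277–309 [Balaban1985Variational] ((127) p.297, (133)–(136) p.298); CMP **96** (1984) 223–250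
[Balaban1984PropagatorsII] ((2.18)–(2.20) p.226); CMP **95** (1984) 17–40 [Balaban1984PropagatorsI] ((1.18) p.20).
-/

set_option autoImplicit false

noncomputable section

open scoped BigOperators InnerProductSpace

namespace Summit.QuantumFields.YangMills.Theorems.Prop7CurrentSlaving

open Literature.MathematicalPhysics.QuantumFieldTheory.Balaban1983to89
open Finset LatticeFieldCalculus B1RG242Torus B6SectAOperatorsV1 B6SectCTwoScaleV1 B6GOneLevelV1Bridge
open Literature.MathematicalPhysics.QuantumFieldTheory.BalabanImbrieJaffe1984to88.BIJ85AxialPropagator411 (BondSpace)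
open Summit.QuantumFields.YangMills.Theorems.Prop7FlatSliceRegularity (exists_QsE_eq_of_orth_ker)
open Summit.QuantumFields.YangMills.Theorems.Prop7FlatCurlCurl (dcsE_dcE_apply)

variable {P : Params} {k : ℕ}

/-- **THE BLOCK AVERAGE OF THE CURL–CURL CURRENT TELESCOPES**: for every real bond field `y` whose plaquette-type combinations
`y(x,ν) + y(x+e_ν,μ) − y(x+e_μ,ν) − y(x,μ)` are bounded by `G`, `|Q_k(∂*∂y)(c′)| ≤ 2(d − 1)·c²·(L^k)⁻¹·G` — `∂*∂y` at a bond of direction `μ` is `c²` times the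
sum over `ν ≠ μ` of transverse differences of those combinations (`Prop7FlatCurlCurl.dcsE_dcE_apply`; the `ν = μ` term vanishes).
[cite: Balaban1984PropagatorsII, (2.19) p.226; Balaban1984PropagatorsI, (1.18) p.20] -/
theorem abs_bondAvgIter_dcsE_dcE_le (hk : k ≤ P.m + P.K) (c : ℝ) (y : BondSpace P) {G : ℝ}
    (hG : ∀ (x : Site P 0) (ν μ : Fin P.d), |y ⟨x, ν⟩ + y ⟨x.shift ν, μ⟩ - y ⟨x.shift μ, ν⟩ - y ⟨x, μ⟩| ≤ G) (c' : PBond P k) :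
    |bondAvgIter k (WithLp.ofLp (dcsE c (dcE c y))) c'| ≤ 2 * ((P.d : ℝ) - 1) * (c ^ 2 * ((P.L : ℝ) ^ k)⁻¹ * G) := by
  set μ : Fin P.d := c'.dir with hμ
  -- the transverse-difference decomposition of `∂*∂y` in the direction `μ`
  set g : Fin P.d → Site P 0 → ℝ := fun ν x => c ^ 2 * (y ⟨x, ν⟩ + y ⟨x.shift ν, μ⟩ - y ⟨x.shift μ, ν⟩ - y ⟨x, μ⟩) with hg
  have hGg : ∀ ν x, |g ν x| ≤ c ^ 2 * G := by
    intro ν x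
    simp only [hg, abs_mul, abs_pow, sq_abs]
    exact mul_le_mul_of_nonneg_left (hG x ν μ) (sq_nonneg c)
  have hgμ : ∀ x, g μ x = 0 := fun x => by simp only [hg]; ring
  have hX : ∀ x : Site P 0, |(WithLp.ofLp (dcsE c (dcE c y))) ⟨x, μ⟩
      - ∑ ν ∈ (Finset.univ : Finset (Fin P.d)).erase μ, (g ν (x.unshift ν) - g ν x)| ≤ 0 := by
    intro x
    have h1 : (WithLp.ofLp (dcsE c (dcE c y))) ⟨x, μ⟩ = ∑ ν : Fin P.d, (g ν (x.unshift ν) - g ν x) := by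
      show dcsE c (dcE c y) ⟨x, μ⟩ = _
      rw [dcsE_dcE_apply, Finset.mul_sum]
      refine Finset.sum_congr rfl fun ν _ => ?_
      simp only [hg, B10StarCount.shift_unshift]
      ring
    have h2 : ∑ ν ∈ (Finset.univ : Finset (Fin P.d)).erase μ, (g ν (x.unshift ν) - g ν x) = ∑ ν : Fin P.d, (g ν (x.unshift ν) - g ν x) := by
      apply Finset.sum_erase
      rw [hgμ, hgμ, sub_self]
    rw [h1, h2, sub_self, abs_zero]
  have h := abs_bondAvgIter_le_of_transverseDiff hk (WithLp.ofLp (dcsE c (dcE c y))) c' ((Finset.univ : Finset (Fin P.d)).erase μ) g hGg hX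
  have hcard : ((((Finset.univ : Finset (Fin P.d)).erase μ).card : ℕ) : ℝ) = (P.d : ℝ) - 1 := by
    rw [Finset.card_erase_of_mem (Finset.mem_univ _), Finset.card_univ, Fintype.card_fin, Nat.cast_sub P.hd]
    push_cast
    ring
  rw [hcard, add_zero] at h
  refine h.trans (le_of_eq ?_)
  ring

/-- **THE EXACTLY CRITICAL FLAT MODEL: THE CURRENT IS SLAVED TO THE PLAQUETTE VARIABLE.**  On the one-level structure `twoScale k _ ∅` (constraints = the
bonds of `T^{(k)}`), let `y` satisfy print's (127): `⟨δ, ∂*∂y + r⟩ = 0` for every `δ` with `Qδ = 0`, with `sup|r| ≤ ρ` and plaquette-type combinations bounded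
by `G`.  Then `|(∂*∂y)(b)| ≤ 6(d − 1)·c²·(L^k)⁻¹·G + 4ρ` at every bond: `∂*∂y + r` IS a multiplier current `Q*ω` (`(ker Q)ᗮ = range Q*`), a multiplier current is
bounded by three times its block averages, and the block averages of `∂*∂y` telescope. [cite: Balaban1985Variational, (127) p.297, (133)-(136) p.298] -/
theorem abs_dcsE_dcE_le_of_critical (hk1 : k + 1 ≤ P.m + P.K) (c : ℝ) (y r : BondSpace P)
    (hcrit : ∀ δ, QE (twoScale k hk1 (∅ : Finset (Site P (k + 1)))) δ = 0 → ⟪δ, dcsE c (dcE c y) + r⟫_ℝ = 0)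
    {G ρ : ℝ} (hG : ∀ (x : Site P 0) (ν μ : Fin P.d), |y ⟨x, ν⟩ + y ⟨x.shift ν, μ⟩ - y ⟨x.shift μ, ν⟩ - y ⟨x, μ⟩| ≤ G)
    (hr : ∀ b, |r b| ≤ ρ) (b : PBond P 0) :
    |dcsE c (dcE c y) b| ≤ 6 * ((P.d : ℝ) - 1) * (c ^ 2 * ((P.L : ℝ) ^ k)⁻¹ * G) + 4 * ρ := by
  have hk : k ≤ P.m + P.K := by omega
  -- the current is a multiplier current
  obtain ⟨ω, hω⟩ := exists_QsE_eq_of_orth_ker (twoScale k hk1 (∅ : Finset (Site P (k + 1)))) hcrit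
  set j : PBond P 0 → ℝ := fun b' => dcsE c (dcE c y) b' + r b' with hj
  set W : PBond P k → ℝ := fun c' => ω (bondIdxOfEmpty hk1 c') with hW
  set A : PBond P 0 → ℝ := fun b' => (((P.L : ℝ) ^ k) ^ P.d * (P.L : ℝ) ^ k)⁻¹ *
        (((((b'.src b'.dir).val % P.L ^ k : ℕ) : ℝ) + 1) * W ⟨Site.proj k k b'.src, b'.dir⟩
          + ((P.L ^ k - 1 - (b'.src b'.dir).val % P.L ^ k : ℕ) : ℝ) * W ⟨(Site.proj k k b'.src).unshift b'.dir, b'.dir⟩) with hAdef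
  have hA : ∀ b' : PBond P 0, A b' = (((P.L : ℝ) ^ k) ^ P.d * (P.L : ℝ) ^ k)⁻¹ *
        (((((b'.src b'.dir).val % P.L ^ k : ℕ) : ℝ) + 1) * W ⟨Site.proj k k b'.src, b'.dir⟩
          + ((P.L ^ k - 1 - (b'.src b'.dir).val % P.L ^ k : ℕ) : ℝ) * W ⟨(Site.proj k k b'.src).unshift b'.dir, b'.dir⟩) := fun b' => rfl
  have hjA : ∀ b', |j b' - A b'| ≤ 0 := by
    intro b'
    have h1 : A b' = QsE (twoScale k hk1 (∅ : Finset (Site P (k + 1)))) ω b' := (QsE_twoScale_empty_apply hk1 ω b').symm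
    have h2 : QsE (twoScale k hk1 (∅ : Finset (Site P (k + 1)))) ω b' = j b' := by
      rw [hω]; rfl
    rw [h1, h2, sub_self, abs_zero]
  -- the block averages of the current
  have hρ : 0 ≤ ρ := (abs_nonneg _).trans (hr b)
  have hM : ∀ c' : PBond P k, |bondAvgIter k j c'| ≤ 2 * ((P.d : ℝ) - 1) * (c ^ 2 * ((P.L : ℝ) ^ k)⁻¹ * G) + ρ := by
    intro c'
    have e : bondAvgIter k j c' = bondAvgIter k (WithLp.ofLp (dcsE c (dcE c y))) c' + bondAvgIter k (WithLp.ofLp r) c' := by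
      have : j = (WithLp.ofLp (dcsE c (dcE c y))) + (WithLp.ofLp r) := by funext b'; rfl
      rw [this, ← B6SectAOntoV1.bondAvgIterLin_apply, map_add]
      rfl
    rw [e]
    have h2 : |bondAvgIter k (WithLp.ofLp r) c'| ≤ ρ := by
      have := Literature.MathematicalPhysics.QuantumFieldTheory.BalabanImbrieJaffe1984to88.BIJ85GaugeFnBound513.norm_bondAvgIter_le k
        (WithLp.ofLp r) (a := ρ) (fun b' => by rw [Real.norm_eq_abs]; exact hr b') c'
      rwa [Real.norm_eq_abs] at this
    exact (abs_add_le _ _).trans (add_le_add (abs_bondAvgIter_dcsE_dcE_le hk c y hG c') h2)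
  have h := abs_le_of_sub_adjField_le hk W A hA j hjA hM b
  have h3 : |dcsE c (dcE c y) b| ≤ |j b| + |r b| := by
    have : dcsE c (dcE c y) b = j b - r b := by simp only [hj]; ring
    rw [this]; exact abs_sub _ _
  linarith [hr b]

end Summit.QuantumFields.YangMills.Theorems.Prop7CurrentSlaving

end
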